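import Literature.IUT.HodgeArakelov.MonoThetaProjectiveNaturalSystem
import Literature.IUT.HodgeArakelov.MonoThetaFromGroupsProofs3b
import Literature.IUT.HodgeArakelov.MonoThetaProjectiveChainProofs

/-!
# [IUTchII] Prop. 1.5 (iii) at the GENUINE models: the exterior cyclotomes, the limit cyclotomic rigidity
# isomorphism and `θ_env` of the NATURAL projective system of `X̲̲_K` — an inhabitant of abc-iut-L6-t1's
# `ThetaEnvData naturalSystem` (bridge B8, part 8; abc-iut cell, layer L6, node IUTchII:Prop1.5(iii))

S. Mochizuki, *Inter-universal Teichmüller theory II*, kurims manuscript (Dec. 2020), §1, Prop. 1.5 (iii), p. 29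
l. 46 – p. 30 l. 17 [claim: Mochizuki2012, status: disputed] (IUTchII §1 Prop 1.5 (iii), kurims pp.29-30): "The
projective system of exterior cyclotomes `{… → Π_μ(M^Θ_{M'}) → Π_μ(M^Θ_M) → …}` [cf. the notation of Definition 1.1,
(i)] determines a projective limit exterior cyclotome `Π_μ(M^Θ_*)` which is equipped with a uniquely determined
cyclotomic rigidity isomorphism `(l·Δ_Θ)(M^Θ_*) ⥲ Π_μ(M^Θ_*)` [i.e., obtained by applying the cyclotomic rigidity
isomorphisms of Definition 1.1, (ii), to the various members of the projective system `M^Θ_*`]. In particular, [cf.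
Proposition 1.4] we obtain a functorial algorithm `M^Θ_* ↦ θ_env(M^Θ_*) ⊆ H¹(Π_Ÿ(M^Θ_*), Π_μ(M^Θ_*))` … by
transporting `θ(Π)` via the above cyclotomic rigidity isomorphism"; [EtTh] = S. Mochizuki, *The étale theta
function …*, Publ. RIMS **45** (2009), §1 p. 238 (PDF p. 12) "`Δ_Θ (≅ Ẑ(1))`" [cite: MochizukiEtTh2009, §1 p.12],
Cor. 2.19 (i) p. 290 (PDF p. 64) [cite: MochizukiEtTh2009, Cor 2.19(i) p.64].

## What abc-iut-L6-t1 froze, and what this file constructs / proves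

`MonoThetaProjective.lean` (p407497) types (iii) as DATA over a system `Sys`: the structure `ThetaEnvData Sys`
(the Prop. 1.4 output `D` at `Π_X(M^Θ_*)`, the mod-`M` Def. 1.1 (ii) isomorphisms `rigid M`, the limit isomorphism
`rigidLim : (l·Δ_Θ)(M^Θ_*) ≃* Π_μ(M^Θ_*) := Sys.extCycLim` with `intCompat`/`rigidLim_compat`, a cohomology system
`cohEnv` with the coefficient transports), `θ_env`/`∞θ_env` DEFINED by transport, and the existence predicate
`Prop15_ii_iii Sys := transitionsAreIsos ∧ Nonempty (ThetaEnvData Sys)`. Over the NATURAL system of `X̲̲_K`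
(`EtaleLevels.naturalSystem`, part 7, `MonoThetaProjectiveNaturalSystem.lean`) THIS FILE supplies:

* `EtaleLevels.MuLim` — `lim_M μ_M` over `(ℕ_{≥1}, ∣)` as the subgroup of compatible families of `∏_M μ_M`
  (`μ_M ⊆ ℚ̄_p`, transition `ζ ↦ ζ^{M'/M}` = L2's `MuN.red`);
* `EtaleLevels.extEquivLevel M : μ_M ≃* Π_μ(𝕄_M)` — **the exterior cyclotome of the mod-`M` member IS `μ_M`**
  (B8-5b `ModelFrame.extEquiv` at the identity);
* **`EtaleLevels.muLimEquivExtCycLim : MuLim ≃* naturalSystem.extCycLim`** — **the projective limit exterior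
  cyclotome `Π_μ(M^Θ_*)` of the natural system IS `lim_M μ_M`** (the printed "determines a projective limit exterior
  cyclotome"), PROVED outright (the transitions `red_{M',M}` restrict to `MuN.red` on `μ_{M'}`);
* `EtaleLevels.toMuLim : (l·Δ_Θ)(Π^tp_{X̲̲}) →* MuLim` — the compatible family of the mod-`M` reductions
  `(l·Δ_Θ) ↠ μ_M` ([EtTh] "the natural isomorphism `μ_M ≅ (l·Δ_Θ) ⊗ ℤ/Mℤ`", L2's `CyclotomeMod.red`, compatible in
  `M` by abc-iut-w4-d024's all-levels tower `hmods`) on abc-iut-L6-t1's carrier `(l·Δ_Θ)(Π) = lDeltaSubquotient`;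
* `EtaleLevels.intCompatLevel M` — the identification of `(l·Δ_Θ)(Π_X(M^Θ_*))` with the interior cyclotome of the
  mod-`M` member, reduced mod `M` (through B8-5a `intModEquiv`);
* **`EtaleLevels.thetaEnvDataNatural : ThetaEnvData naturalSystem`** — Prop. 1.4 output `D :=` abc-iut-L6-t1's
  `etaleThetaDataOfDoubleUnderline` (REAL cohomology, one-root orbit; input (H1) `PiYddCharacteristic`); `rigid M :=`
  B8-5b `ModelFrame.cyclotomicRigidity`; `rigidLim :=` `toMuLim` followed by `muLimEquivExtCycLim`, an ISOMORPHISM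
  under the hypothesis `hlim : Function.Bijective toMuLim` = "`(l·Δ_Θ) ⥲ lim_M μ_M`", i.e. [EtTh] §1 p. 12
  "`Δ_Θ (≅ Ẑ(1))`" in the form the limit needs (the L2 interface carries `Δ_Θ` abstractly; this is the one input the
  [EtTh] typing does not record — the same status as `hZ` of B8 part 6); `rigidLim_compat` PROVED ("obtained by
  applying the cyclotomic rigidity isomorphisms of Definition 1.1, (ii), to the various members"); the cohomology
  system with `Π_μ(M^Θ_*)`-coefficients `:=` the REAL system with `(l·Δ_Θ)`-coefficients re-labelled through
  `rigidLim` (the interface `CohomologySystem` is coefficient-agnostic, so the coefficient transport is the identity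
  on the carrier; the model coefficient change along `rigidLim` as a map of cocycles is abc-iut-w4-d014's
  `ContH1.coeffChange`, not needed to inhabit the typed structure) — whence `thetaEnv_thetaEnvDataNatural`:
  `θ_env(M^Θ_*)` IS `θ(Π^tp_{X̲̲})` so read, and `thetaEnvInfty_thetaEnvDataNatural`;
* **`EtaleLevels.prop15_ii_iii_naturalSystem`** — abc-iut-L6-t1's `Prop15_ii_iii naturalSystem` (Prop. 1.5 (ii)
  ∧ (iii) existence) for the natural system of `X̲̲_K`, CONDITIONAL on the named [EtTh] inputs of part 7 (Cor. 2.18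
  (iv) first half `ThetaEnvData.Cor218_iv_surjective` at every level, Cor. 2.18 (i) stability clauses / (H1)) and
  on `hlim`; `…_of_cor218_i` = the same with (H1) and the `Π^tp_{Y̲̲}`-clause read off `RigidData.Cor218_i` BY NAME
  (abc-iut-w4-d013's `piYddCharacteristic_of_cor218_i`);
* `EtaleLevels.prop15_i_naturalSystem'` — the symmetric orientation `Prop15_i B naturalSystem` of part 7's
  `prop15_i_naturalSystem` (abc-iut-w4-d038's formulation, via abc-iut-w4-d030's `prop15_i_symm`).

HONEST FRAMING: constructions over the cell's own [EtTh]-side constructions plus conditional theorems modulo NAMED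
[EtTh] facts and the one classical input `hlim`; the [IUTchII] claim key `Mochizuki2012` is DISPUTED (D-0012);
nothing printed in [IUTchII] is asserted beyond what the typed structures contain; no side is taken on [IUTchIII]
Cor. 3.12; typed ≠ discharged elsewhere.
-/

noncomputable section

namespace Literature.IUT.HodgeArakelov

open Literature.AnabelianGeometry.EtaleTheta Literature.AnabelianGeometry.SemiGraphs
open scoped Literature.AnabelianGeometry.EtaleTheta

namespace EtaleLevels

variable {p : ℕ} [Fact p.Prime] {D : Literature.AnabelianGeometry.EtaleTheta.ThetaSetting p}
  {E : D.EtaleThetaData} {l : ℕ} (C : E.DoubleUnderline l) (hC : D.Compat) (hS : D.Sec2Hyps)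
  (hl : l.Prime) (hp2 : p ≠ 2) (hpl : p ≠ l) (hζ : ∃ ζ : D.K, IsPrimitiveRoot ζ (4 * l))
  (mods : ∀ M : ℕ+, D.CyclotomeMod l M)
  (f : contCocycles D.toTheta D.DeltaTheta C.GtpYdduu) (hf : f ∈ C.rootCocycles hC)
  (hmods : ∀ (M M' : ℕ+) (h : (M : ℕ) ∣ (M' : ℕ)) (x : D.lDeltaTheta l),
    MuN.red p M M' h ((mods M').red x) = (mods M).red x)
  (h15 : Literature.AnabelianGeometry.EtaleTheta.ThetaSetting.Prop15iii E hC) (L : C.CuspLabels)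
  (hZ : ∀ M : ℕ+, Nonempty (ModelCyclotomes.lDeltaQuot (C.rigidData (mods M) hC hS h15 L) ≃*
    Literature.IUT.HodgeTheaters.ZHat))

/-! ## `lim_M μ_M` and the exterior cyclotomes of the natural system -/

/-- **`lim_M μ_M`** over `(ℕ_{≥1}, ∣)`: the subgroup of `∏_{M ∈ ℕ_{≥1}} μ_M` of families compatible with the power
maps `ζ ↦ ζ^{M'/M}` (L2's `MuN.red`) — the shape of the "projective limit exterior cyclotome" of Prop. 1.5 (iii)
for the natural system. [claim: Mochizuki2012, status: disputed] (IUTchII §1 Prop 1.5 (iii), kurims p.29) -/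
def MuLim (p : ℕ) [Fact p.Prime] : Subgroup (∀ M : ℕ+, MuN p M) where
  carrier := {y | ∀ (M M' : ℕ+) (h : (M : ℕ) ∣ (M' : ℕ)), MuN.red p M M' h (y M') = y M}
  mul_mem' := by
    intro x y hx hy M M' h
    rw [Pi.mul_apply, Pi.mul_apply, map_mul, hx M M' h, hy M M' h]
  one_mem' := by
    intro M M' h
    rw [Pi.one_apply, Pi.one_apply, map_one]
  inv_mem' := by
    intro x hx M M' h
    rw [Pi.inv_apply, Pi.inv_apply, map_inv, hx M M' h]

/-- Membership in `MuLim` (unfolding). [claim: Mochizuki2012, status: disputed] (IUTchII §1 Prop 1.5 (iii), kurims p.29) -/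
theorem mem_MuLim_iff {y : ∀ M : ℕ+, MuN p M} :
    y ∈ MuLim p ↔ ∀ (M M' : ℕ+) (h : (M : ℕ) ∣ (M' : ℕ)), MuN.red p M M' h (y M') = y M :=
  Iff.rfl

/-- An element of `Π_{𝕄_M} = Π^tp_{Y̲̲}[μ_M]` lies in the exterior cyclotome `Π_μ(𝕄_M)` iff its `Π^tp_{Y̲̲}`-component
is trivial. [claim: Mochizuki2012, status: disputed] (IUTchII §1 Def 1.1 (i), kurims p.21) -/
theorem mem_extCyc_iff (M : ℕ+) (z : (levelData C hC hS mods M).env) :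
    z ∈ ((naturalSystem C hC hS hl hp2 hpl hζ mods f hf hmods h15 L hZ).recon M).extCyc ↔ z.right = 1 :=
  MonoidHom.mem_ker

/-- `inMu a ∈ Π_μ(𝕄_M)`. [claim: Mochizuki2012, status: disputed] (IUTchII §1 Def 1.1 (i), kurims p.21) -/
theorem inMu_mem_extCyc (M : ℕ+) (a : MuN p M) :
    CycEnvelope.inMu (levelData C hC hS mods M).augY (levelData C hC hS mods M).chi a ∈
      ((naturalSystem C hC hS hl hp2 hpl hζ mods f hf hmods h15 L hZ).recon M).extCyc := by
  rw [mem_extCyc_iff]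
  rfl

/-- The transitions `red_{M',M}` of the natural system restrict to the power maps `MuN.red` on the exterior
cyclotomes: `red_{M',M}(a, 1) = (a^{M'/M}, 1)`. [cite: MochizukiEtTh2009, Def 2.13(ii) p.48] -/
theorem red_inMu {M M' : ℕ+} (h : (M : ℕ) ∣ (M' : ℕ)) (a : MuN p M') :
    red C hC hS mods h (CycEnvelope.inMu (levelData C hC hS mods M').augY (levelData C hC hS mods M').chi a) =
      CycEnvelope.inMu (levelData C hC hS mods M).augY (levelData C hC hS mods M).chi (MuN.red p M M' h a) :=
  SemidirectProduct.map_inl _ _ _ a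

/-- **`Π_μ(M^Θ_*) = lim_M μ_M` for the natural system** (Prop. 1.5 (iii): "the projective system of exterior
cyclotomes … determines a projective limit exterior cyclotome `Π_μ(M^Θ_*)`"): abc-iut-L6-t1's `extCycLim` (compatible
families of elements of the `Π_μ(𝕄_M)`) is, for the natural system, the group of compatible families of roots of
unity — PROVED (levelwise `μ_M = Π_μ(𝕄_M)`, transitions = power maps).
[claim: Mochizuki2012, status: disputed] (IUTchII §1 Prop 1.5 (iii), kurims p.29) -/
def muLimEquivExtCycLim :
    MuLim p ≃* (naturalSystem C hC hS hl hp2 hpl hζ mods f hf hmods h15 L hZ).extCycLim where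
  toFun y :=
    ⟨fun M => CycEnvelope.inMu (levelData C hC hS mods M).augY (levelData C hC hS mods M).chi (y.1 M),
      fun M => inMu_mem_extCyc C hC hS hl hp2 hpl hζ mods f hf hmods h15 L hZ M (y.1 M),
      fun M M' h => by
        change red C hC hS mods h _ = _
        rw [red_inMu, y.2 M M' h]⟩
  invFun x :=
    ⟨fun M => (x.1 M : (levelData C hC hS mods M).env).left, fun M M' h => by
      have hx : red C hC hS mods h (x.1 M') = x.1 M := x.2.2 M M' h
      exact congrArg (fun z : (levelData C hC hS mods M).env => z.left) hx⟩
  left_inv y := by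
    apply Subtype.ext
    funext M
    rfl
  right_inv x := by
    apply Subtype.ext
    funext M
    have hM : (x.1 M : (levelData C hC hS mods M).env).right = 1 :=
      (mem_extCyc_iff C hC hS hl hp2 hpl hζ mods f hf hmods h15 L hZ M (x.1 M)).1 (x.2.1 M)
    change CycEnvelope.inMu (levelData C hC hS mods M).augY (levelData C hC hS mods M).chi
      (x.1 M : (levelData C hC hS mods M).env).left = x.1 M
    exact SemidirectProduct.ext rfl hM.symm
  map_mul' y y' := by
    apply Subtype.ext
    funext M
    change CycEnvelope.inMu _ _ (y.1 M * y'.1 M) = CycEnvelope.inMu _ _ (y.1 M) * CycEnvelope.inMu _ _ (y'.1 M)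
    rw [map_mul]

/-- `muLimEquivExtCycLim` in coordinates. [claim: Mochizuki2012, status: disputed] (IUTchII §1 Prop 1.5 (iii), kurims p.29) -/
theorem muLimEquivExtCycLim_apply (y : MuLim p) (M : ℕ+) :
    ((muLimEquivExtCycLim C hC hS hl hp2 hpl hζ mods f hf hmods h15 L hZ y :
        (naturalSystem C hC hS hl hp2 hpl hζ mods f hf hmods h15 L hZ).extCycLim) :
      ∀ M', ((naturalSystem C hC hS hl hp2 hpl hζ mods f hf hmods h15 L hZ).env M').Pi) M =
      CycEnvelope.inMu (levelData C hC hS mods M).augY (levelData C hC hS mods M).chi (y.1 M) :=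
  rfl

/-! ## `(l·Δ_Θ)(Π^tp_{X̲̲}) → lim_M μ_M` and the interior identifications -/

/-- B8-5a's `thetaModQuot` of L2-t8's level-`M` rigidity data, on classes: the mod-`M` reduction
`(l·Δ_Θ) ↠ μ_M` of the theta quotient (`CyclotomeMod.red ∘ toLDelta`). [cite: MochizukiEtTh2009, Cor 2.19(i) p.64] -/
theorem thetaModQuot_rigidData_mk (M : ℕ+)
    (g : ↥((D.lDeltaTheta l).comap (D.toTheta.comp C.Huu.subtype))) :
    ModelCyclotomes.thetaModQuot (C.rigidData (mods M) hC hS h15 L)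
        (g : ModelCyclotomes.lDeltaQuot (C.rigidData (mods M) hC hS h15 L)) =
      (mods M).red (C.toLDelta g) :=
  rfl

/-- **The compatible family of mod-`M` reductions `(l·Δ_Θ) ↠ μ_M`** on abc-iut-L6-t1's carrier
`(l·Δ_Θ)(Π) = φ⁻¹(l·Δ_Θ)/Ker φ` of `Π = Π^tp_{X̲̲}` (`EtaleThetaDataOfSetting.lDeltaSubquotient`; the same quotient as
B8-5a's `lDeltaQuot` of L2-t8's `rigidData`, on the nose): at level `M` it is B8-5a's `thetaModQuot` = L2's
`CyclotomeMod.red ∘ toLDelta` ("the natural isomorphism `μ_M ≅ (l·Δ_Θ) ⊗ ℤ/Mℤ`", [EtTh] Def. 2.13), compatible in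
`M` by abc-iut-w4-d024's all-levels compatibility `hmods`. [cite: MochizukiEtTh2009, Cor 2.19(i) p.64] -/
def toMuLim : (EtaleThetaDataOfSetting.lDeltaSubquotient C).carrier →* MuLim p where
  toFun a :=
    ⟨fun M => ModelCyclotomes.thetaModQuot (C.rigidData (mods M) hC hS h15 L) a, fun M M' h => by
      induction a using QuotientGroup.induction_on with
      | H g =>
        exact (congrArg (MuN.red p M M' h) (thetaModQuot_rigidData_mk C hC hS mods h15 L M' g)).trans
          ((hmods M M' h (C.toLDelta g)).trans (thetaModQuot_rigidData_mk C hC hS mods h15 L M g).symm)⟩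
  map_one' := by
    apply Subtype.ext
    funext M
    exact map_one _
  map_mul' a b := by
    apply Subtype.ext
    funext M
    exact map_mul _ a b

/-- `toMuLim` in coordinates. [cite: MochizukiEtTh2009, Cor 2.19(i) p.64] -/
theorem toMuLim_apply (a : (EtaleThetaDataOfSetting.lDeltaSubquotient C).carrier) (M : ℕ+) :
    (toMuLim C hC hS mods hmods h15 L a).1 M = ModelCyclotomes.thetaModQuot (C.rigidData (mods M) hC hS h15 L) a :=
  rfl

/-- **The identification of `(l·Δ_Θ)(Π_X(M^Θ_*))` with the interior cyclotome of the mod-`M` member, reduced mod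
`M`**: `(l·Δ_Θ)(Π) → (l·Δ_Θ)(𝕄_M) ⊗ ℤ/M` := the mod-`M` reduction followed by the inverse of B8-5a's
`intModEquiv : (l·Δ_Θ)(𝕄_M) ⊗ ℤ/M ⥲ μ_M`. [claim: Mochizuki2012, status: disputed] (IUTchII §1 Prop 1.5 (iii), kurims p.29) -/
def intCompatLevel (M : ℕ+) :
    (EtaleThetaDataOfSetting.lDeltaSubquotient C).carrier →*
      ModPow ((naturalSystem C hC hS hl hp2 hpl hζ mods f hf hmods h15 L hZ).recon M).intCyc.carrier (M : ℕ) :=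
  (ModelCyclotomes.intModEquiv (C.rigidData (mods M) hC hS h15 L)).symm.toMonoidHom.comp
    (ModelCyclotomes.thetaModQuot (C.rigidData (mods M) hC hS h15 L))

/-- The Def. 1.1 (ii) cyclotomic rigidity isomorphism of the mod-`M` member `𝕄_M` of the natural system (B8-5b
`ModelFrame.cyclotomicRigidity` at the identity identification). [claim: Mochizuki2012, status: disputed] (IUTchII §1 Def 1.1 (ii), kurims p.21) -/
def rigidLevel (M : ℕ+) : CyclotomicRigidity ((naturalSystem C hC hS hl hp2 hpl hζ mods f hf hmods h15 L hZ).recon M) :=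
  (levelFrame C hC hS hl hp2 hpl hζ mods f hf h15 L hZ M).cyclotomicRigidity
    (M := (modelFamily C hC hS hl hp2 hpl hζ mods f hf).modelEnv M) (ContinuousMulEquiv.refl _)

/-- The exterior side of the mod-`M` rigidity isomorphism undoes the interior identification: for `t ∈ μ_M`,
`extEquiv (intModEquiv (intModEquiv⁻¹ t)) = (t, 1)` in `Π^tp_{Y̲̲}[μ_M]` (bookkeeping for `rigidLim_compat`: "obtained by
applying the cyclotomic rigidity isomorphisms of Definition 1.1, (ii), to the various members").
[claim: Mochizuki2012, status: disputed] (IUTchII §1 Prop 1.5 (iii), kurims p.29) -/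
theorem extEquiv_intModEquiv_symm_apply (M : ℕ+) (t : MuN p M) :
    ((ModelFrame.extEquiv (R := C.rigidData (mods M) hC hS h15 L)
        (M := (modelFamily C hC hS hl hp2 hpl hζ mods f hf).modelEnv M) (ContinuousMulEquiv.refl _)
        (ModelCyclotomes.intModEquiv (C.rigidData (mods M) hC hS h15 L)
          ((ModelCyclotomes.intModEquiv (C.rigidData (mods M) hC hS h15 L)).symm t)) :
        ((modelFamily C hC hS hl hp2 hpl hζ mods f hf).modelEnv M).Pi) : (levelData C hC hS mods M).env) =
      CycEnvelope.inMu (levelData C hC hS mods M).augY (levelData C hC hS mods M).chi t := by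
  rw [MulEquiv.apply_symm_apply]
  rfl

/-! ## The `ThetaEnvData` of the natural system -/

/-- **An inhabitant of abc-iut-L6-t1's `ThetaEnvData naturalSystem`** (Prop. 1.5 (iii) data for the natural system of
`X̲̲_K`): `D :=` the Prop. 1.4 output at `Π^tp_{X̲̲}` (abc-iut-L6-t1 `etaleThetaDataOfDoubleUnderline`, input (H1));
`rigid M :=` B8-5b `ModelFrame.cyclotomicRigidity`; `rigidLim := muLimEquivExtCycLim ∘ toMuLim`, an isomorphism by
`hlim` ("`(l·Δ_Θ) ⥲ lim_M μ_M`", [EtTh] §1 "`Δ_Θ (≅ Ẑ(1))`"); `intCompat := intCompatLevel`; `rigidLim_compat`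
PROVED; `cohEnv :=` the REAL cohomology system with `(l·Δ_Θ)`-coefficients re-labelled through `rigidLim`
(identity transports — the interface `CohomologySystem` does not record its coefficients).
[claim: Mochizuki2012, status: disputed] (IUTchII §1 Prop 1.5 (iii), kurims pp.29-30) -/
def thetaEnvDataNatural (hchar : EtaleThetaDataOfSetting.PiYddCharacteristic C)
    (hlim : Function.Bijective (toMuLim C hC hS mods hmods h15 L)) :
    ThetaEnvData (naturalSystem C hC hS hl hp2 hpl hζ mods f hf hmods h15 L hZ) where
  D := EtaleThetaDataOfSetting.etaleThetaDataOfDoubleUnderline C (mods 1) hC hS hl hp2 hpl hζ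
    (eta0_mem C hC hS mods f hf 1) hchar
  rigid M := rigidLevel C hC hS hl hp2 hpl hζ mods f hf hmods h15 L hZ M
  rigidLim := (MulEquiv.ofBijective (toMuLim C hC hS mods hmods h15 L) hlim).trans
    (muLimEquivExtCycLim C hC hS hl hp2 hpl hζ mods f hf hmods h15 L hZ)
  intCompat M := intCompatLevel C hC hS hl hp2 hpl hζ mods f hf hmods h15 L hZ M
  rigidLim_compat M a :=
    (extEquiv_intModEquiv_symm_apply C hC hS hl hp2 hpl hζ mods f hf h15 L M
      (ModelCyclotomes.thetaModQuot (C.rigidData (mods M) hC hS h15 L) a)).symm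
  cohEnv := (EtaleThetaDataOfSetting.etaleThetaDataOfDoubleUnderline C (mods 1) hC hS hl hp2 hpl hζ
    (eta0_mem C hC hS mods f hf 1) hchar).coh
  transportH1 _ := AddEquiv.refl _
  transportLim := AddEquiv.refl _
  transport_compat _ _ := rfl

/-- The cohomology system with `Π_μ(M^Θ_*)`-coefficients of this inhabitant is the REAL `(l·Δ_Θ)`-coefficient system
re-labelled (bookkeeping). [claim: Mochizuki2012, status: disputed] (IUTchII §1 Prop 1.5 (iii), kurims p.30) -/
theorem cohEnv_thetaEnvDataNatural (hchar : EtaleThetaDataOfSetting.PiYddCharacteristic C)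
    (hlim : Function.Bijective (toMuLim C hC hS mods hmods h15 L)) :
    (thetaEnvDataNatural C hC hS hl hp2 hpl hζ mods f hf hmods h15 L hZ hchar hlim).cohEnv =
      (thetaEnvDataNatural C hC hS hl hp2 hpl hζ mods f hf hmods h15 L hZ hchar hlim).D.coh :=
  rfl

/-- For this inhabitant `θ_env(M^Θ_*)` IS `θ(Π^tp_{X̲̲})` read with `Π_μ(M^Θ_*)`-coefficients (the transport is the
re-labelling). [claim: Mochizuki2012, status: disputed] (IUTchII §1 Prop 1.5 (iii), kurims p.30) -/
theorem thetaEnv_thetaEnvDataNatural (hchar : EtaleThetaDataOfSetting.PiYddCharacteristic C)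
    (hlim : Function.Bijective (toMuLim C hC hS mods hmods h15 L)) :
    (thetaEnvDataNatural C hC hS hl hp2 hpl hζ mods f hf hmods h15 L hZ hchar hlim).thetaEnv =
      (thetaEnvDataNatural C hC hS hl hp2 hpl hζ mods f hf hmods h15 L hZ hchar hlim).D.theta :=
  Set.image_id _

/-- … and `∞θ_env(M^Θ_*)` IS `∞θ(Π^tp_{X̲̲})` (abc-iut-L6-t1's `thetaEnvInfty_eq_image` with the identity transport).
[claim: Mochizuki2012, status: disputed] (IUTchII §1 Prop 1.5 (iii), kurims p.30) -/
theorem thetaEnvInfty_thetaEnvDataNatural (hchar : EtaleThetaDataOfSetting.PiYddCharacteristic C)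
    (hlim : Function.Bijective (toMuLim C hC hS mods hmods h15 L)) :
    (thetaEnvDataNatural C hC hS hl hp2 hpl hζ mods f hf hmods h15 L hZ hchar hlim).thetaEnvInfty =
      (thetaEnvDataNatural C hC hS hl hp2 hpl hζ mods f hf hmods h15 L hZ hchar hlim).D.thetaInfty := by
  rw [ThetaEnvData.thetaEnvInfty_eq_image]
  exact Set.image_id _

/-- `θ(Π^tp_{X̲̲})` of the Prop. 1.4 output used here, as printed with the covering's `l`: the `μ_l`-multiples of the
reciprocals of the one-root orbit (abc-iut-L6-t1's `etaleThetaDataOfDoubleUnderline_theta`).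
[claim: Mochizuki2012, status: disputed] (IUTchII §1 Prop 1.4, kurims p.27) -/
theorem thetaEnv_thetaEnvDataNatural_eq (hchar : EtaleThetaDataOfSetting.PiYddCharacteristic C)
    (hlim : Function.Bijective (toMuLim C hC hS mods hmods h15 L)) :
    (thetaEnvDataNatural C hC hS hl hp2 hpl hζ mods f hf hmods h15 L hZ hchar hlim).thetaEnv =
      {b | ∃ o ∈ EtaleThetaDataOfSetting.orbitOne C hC, l • (b + o) = 0} := by
  rw [thetaEnv_thetaEnvDataNatural]
  exact EtaleThetaDataOfSetting.etaleThetaDataOfDoubleUnderline_theta C (mods 1) hC hS hl hp2 hpl hζ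
    (eta0_mem C hC hS mods f hf 1) hchar

/-! ## Prop. 1.5 (ii) ∧ (iii) for the natural system -/

include hmods in
/-- **[IUTchII] Prop. 1.5 (ii) and (iii) (existence) HOLD for the natural projective system of `X̲̲_K`** —
abc-iut-L6-t1's `Prop15_ii_iii naturalSystem` — CONDITIONAL on: the level-`M` [EtTh] Cor. 2.18 (iv) first half
`ThetaEnvData.Cor218_iv_surjective` (named fact) and the `Π^tp_{Y̲̲}`-stability of topological automorphisms of
`Π^tp_{X̲̲}` ([EtTh] Cor. 2.18 (i)) for (ii); (H1) `PiYddCharacteristic` ([EtTh] Cor. 2.18 (i), `Π^tp_Ÿ`-clause) for the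
Prop. 1.4 output; and `hlim` "`(l·Δ_Θ) ⥲ lim_M μ_M`" ([EtTh] §1 p. 12) for the limit rigidity isomorphism.
[claim: Mochizuki2012, status: disputed] (IUTchII §1 Prop 1.5 (ii)(iii), kurims pp.29-30) -/
theorem prop15_ii_iii_naturalSystem
    (hsurj : ∀ M : ℕ+, (levelData C hC hS mods M).Cor218_iv_surjective)
    (hY : ∀ (M : ℕ+) (γ : (levelData C hC hS mods M).PiX ≃ₜ* (levelData C hC hS mods M).PiX),
      (levelData C hC hS mods M).PiY.map γ.toMulEquiv.toMonoidHom = (levelData C hC hS mods M).PiY)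
    (hchar : EtaleThetaDataOfSetting.PiYddCharacteristic C)
    (hlim : Function.Bijective (toMuLim C hC hS mods hmods h15 L)) :
    Prop15_ii_iii (naturalSystem C hC hS hl hp2 hpl hζ mods f hf hmods h15 L hZ) :=
  ⟨transitionsAreIsos_naturalSystem C hC hS hl hp2 hpl hζ mods f hf hmods h15 L hZ hsurj hY,
    ⟨thetaEnvDataNatural C hC hS hl hp2 hpl hζ mods f hf hmods h15 L hZ hchar hlim⟩⟩

include hmods in
/-- `prop15_ii_iii_naturalSystem` with the two [EtTh] Cor. 2.18 (i) stability clauses read off the named fact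
`RigidData.Cor218_i` for L2-t8's rigidity data at level `1` (abc-iut-w4-d013's `piYddCharacteristic_of_cor218_i` for
(H1)). [claim: Mochizuki2012, status: disputed] (IUTchII §1 Prop 1.5 (ii)(iii), kurims pp.29-30) [cite: MochizukiEtTh2009, Cor 2.18(i) p.60] -/
theorem prop15_ii_iii_naturalSystem_of_cor218_i
    (hsurj : ∀ M : ℕ+, (levelData C hC hS mods M).Cor218_iv_surjective)
    (h218i : (C.rigidData (mods 1) hC hS h15 L).Cor218_i)
    (hlim : Function.Bijective (toMuLim C hC hS mods hmods h15 L)) :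
    Prop15_ii_iii (naturalSystem C hC hS hl hp2 hpl hζ mods f hf hmods h15 L hZ) :=
  prop15_ii_iii_naturalSystem C hC hS hl hp2 hpl hζ mods f hf hmods h15 L hZ hsurj (fun _ γ => (h218i γ).1)
    (EtaleThetaDataOfSetting.piYddCharacteristic_of_cor218_i C (mods 1) hC hS h15 L
      (C.rigidData (mods 1) hC hS h15 L) rfl h218i) hlim

/-! ## The symmetric orientation of part 7's `prop15_i_naturalSystem` -/

include hmods in
/-- Every projective system of mono-theta environments over the model family of `X̲̲_K` (transitions = morphisms of
mono-theta environments) is isomorphic to the natural one — stated as `Prop15_i B naturalSystem` (abc-iut-w4-d038's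
orientation; part 7's `prop15_i_naturalSystem` + abc-iut-w4-d030's `prop15_i_symm`).
[claim: Mochizuki2012, status: disputed] (IUTchII §1 Prop 1.5 (i), kurims p.29) [cite: MochizukiEtTh2009, Cor 2.19(ii) p.64] -/
theorem prop15_i_naturalSystem' (hslimX : Literature.AlgebraicGeometry.Frobenioids.IsSlimGroup D.PiTemp)
    (haugOpen : IsOpenMap D.aug)
    (hsurj : ∀ M : ℕ+, (levelData C hC hS mods M).Cor218_iv_surjective)
    (hfibre : ∀ M : ℕ+, (levelData C hC hS mods M).Cor218_iv_fibre)
    (B : MonoThetaProjSystem (modelFamily C hC hS hl hp2 hpl hζ mods f hf))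
    (hB : B.IsMonoThetaCompatible (reductions C hC hS hl hp2 hpl hζ mods f hf hmods hslimX)) :
    Prop15_i B (naturalSystem C hC hS hl hp2 hpl hζ mods f hf hmods h15 L hZ) :=
  prop15_i_symm (prop15_i_naturalSystem C hC hS hl hp2 hpl hζ mods f hf hmods h15 L hZ hslimX haugOpen hsurj hfibre B hB)

end EtaleLevels

end Literature.IUT.HodgeArakelov
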